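import Literature.Geometry.Kaehler.ComplexTorusAbelianFivefoldSurfaceFactorsConditionD
import HarnessLib

/-!
# Moonen–Zarhin 1999 Thm. (0.2) (4) for the complex abelian FIVEFOLDS `X ∼ Y × E` with `Y` a NON-SIMPLE fourfold, outside
# the cases (e) and (f): `X` satisfies condition (D) — `ℬ•(Xⁿ) = 𝒟•(Xⁿ)` for all `n` — and `Hg(X) = Sp_D(V,φ)`; in
# particular `(T × E_σ) × E_τ` for every polarised abelian threefold `T` and all elliptic curves `E_σ`, `E_τ` such that, when
# `T` is simple, neither CM field `ℚ(σ)`, `ℚ(τ)` embeds into `End⁰(T)`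

Layer `Literature/Geometry/Kaehler`, namespace `Literature.Geometry.Kaehler.ComplexTorus`; lane `lit-hodgefound` (Track 2
foundations library), Layer A4 (known cases of `ℬ = 𝒟`); prover seat `lit-hodgefound-p17`, generation 55, self-proposed row
g55-#2 — sequel of ✔ g55-#1 `ComplexTorusAbelianFivefoldSurfaceFactorsConditionD` (all simple factors of dimension `≤ 2`).
Here the isogeny shapes `(4,1)` ∕ `(1,4)` of the Poincaré split of a non-simple fivefold whose four-dimensional part is NOT
simple (a simple fourfold factor is excluded by «if `X` has no simple factor of dimension 4»).  THEOREMS ONLY (no definition,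
no instance, no notation, no named fact; D-0026 net debt `0`).

## Source, VERBATIM (held `paper:arxiv-math_9901113`; locators are page ∕ line of the materialisation)

B. J. J. Moonen, Yu. G. Zarhin [MoonenZarhin1999LowDim], *Hodge classes on abelian varieties of low dimension*, Math. Ann.
**315** (1999) 711–733.  Thm. (0.2) (4) (p0002 L1–L8): «Suppose we are not in one of the cases (e), (f) or (g). … In
particular, if `X` has no simple factor of dimension 4 then `Hg(X) = Sp_D(V,φ)` and `ℬ•(Xⁿ) = 𝒟•(Xⁿ)` for every `n ≥ 1`.»
The cases (p0001 L77–L80, L127–L140): «(a) The abelian variety `X` is isogenous to a product `X₁ × X₂` where `X₁` is an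
elliptic curve with complex multiplication by an imaginary quadratic field `k` and where `X₂` is a simple abelian threefold
such that there exists an embedding `k ↪ End⁰(X₂)`. … (e) The abelian variety `X` is isogenous to a product `X₁² × X₂`, where
`X₁` and `X₂` are as in (a). (f) The abelian variety `X` is isogenous to a product `X₀ × X₁ × X₂`, where `X₀` is an elliptic
curve, where `X₁` and `X₂` are as in (a), and such that `X₀` and `X₁` are not isogenous. (g) … `X₂` is a simple abelian
fourfold …».  So for `X ∼ (T × E_σ) × E_τ` with `T` a simple threefold, «not (e) and not (f)» reads: if `E_τ` (resp. `E_σ`)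
has complex multiplication by `k`, there is no embedding `k ↪ End⁰(T)` — whether or not `E_σ ∼ E_τ`.  Proof, §5 (5.11)
(p0010 L47–L63): «Write `X ∼ E × Y`, where `E` is an elliptic curve and `dim(Y) = 4`. Without loss of generality we may assume
that `Hom(E,Y) = 0`. (If not then we are reduced to the case `dim(X) ≤ 4`.) Let `d_max` be the maximal dimension of a simple
factor of `X`. If `d_max ≤ 2` then … Proposition (3.8) gives `Hg(X) = Hg(E) × Hg(Y)`. If `d_max = 3` then `Y` is isogenous to
a product of an elliptic curve `Y₁` and a simple abelian threefold `Y₂`. If `End⁰(Y₂)` contains an imaginary quadratic field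
then this subfield is unique. Therefore, possibly after interchanging the roles of `E` and `Y₁` we find that there does not
exist an embedding of `End⁰(E)` into the center of `End⁰(Y)`. (Note that `End⁰(E) = End⁰(Y₁)` implies that `E ∼ Y₁`, which
we excluded.) Again by Proposition (3.8) we then find `Hg(X) = Hg(E) × Hg(Y)`.»; (5.6)–(5.9) (p0009 L122 – p0010 L15) for
the factors without complex multiplication («If `X` contains an elliptic curve `E` then `End⁰(E) = ℚ` … and Theorem (0.2)
follows by Proposition (3.8)»); Prop. (3.8) (p0007 L55–L74); (3.1) (p0006 L53–L65).

* B. B. Gordon [Gordon1999HodgeAVSurvey], *A survey of the Hodge conjecture for abelian varieties*, Thm. 7.5 (1) ⟺ (2),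
  7.6.1–7.6.2.
* J. S. Milne [Milne1999LefschetzClasses], Duke Math. J. **96** (1999), §4 Prop. 4.8.
* H. Lange [Lange2023AbelianVarietiesComplex], *Abelian Varieties over the Complex Numbers* (2023), §1.1.2 Cor. 1.1.16,
  §2.4.4 Thm. 2.4.25 ∕ Cor. 2.4.26, §5.1.5 Exercise (1).

## The argument

`X = (T × E_σ) × E_τ`, `T` a SIMPLE polarised threefold, `E_τ = E` the distinguished curve.  `E_τ` without complex
multiplication: `T × E_σ` is stably nondegenerate (Thm. (0.1) (4) outside case (a), the tree's g51 assembly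
`IsRiemannForm.forall_divisorClasses_powPeriod_prod_ellipticPeriod_eq_hodgeClasses_of_finrank_eq_three_of_forall_apply_ne`) and
the non-CM elliptic factor theorem applies; `E_σ` without complex multiplication: the same after `(T × E_σ) × E_τ ≅ (T × E_τ) ×
E_σ`; both with complex multiplication and `E_σ ∼ E_τ`: `X ∼ T × E_τ²`, «reduced to the case `dim(X) ≤ 4`» (Hazama's power
remark on the stably nondegenerate `T × E_τ`); both with complex multiplication and `E_σ ≁ E_τ`: `Hom(E_τ, T × E_σ) = 0` and by
(3.8) (the tree's CM half for `X₁ × E_{τ'}`,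
`IsAbelianVariety.exists_algHom_center_endAlgRat_or_isIsogenous_of_hodgeGroupC_prod_ellipticPeriod_prod_ellipticPeriod_ne`) a
non-split `Hg(X)` would embed `k = ℚ(τ)` into `Z(End⁰ T) = F` — excluded — or into `End⁰(E_σ)`, forcing `E_σ ∼ E_τ`; so
`Hg(X) = Hg(T × E_σ) × Hg(E_τ)` and (D) transfers ((3.1)).  `T` NOT simple: `T ∼ S × E_ρ` and `X ∼ ((S × E_ρ) × E_σ) × E_τ`
(✔ g55-#1, hypothesis-free).  `X ∼ Y × E_τ` with `Y` a non-simple polarised fourfold: `Y ∼ T × E_σ` or `Y ∼ S₁ × S₂`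
(Poincaré, the tree's `IsRiemannForm.exists_isIsogenous_prod_of_not_isSimple_of_finrank_eq_four`), landing in the previous
shape or in `(S₁ × S₂) × E_τ` (✔ g55-#1).  `Hg(X) = Sp_D(V,φ)` follows from (D) by Gordon's Thm. 7.5 (the tree's A4-103).

## What is proved

* §1 `T` a SIMPLE polarised threefold: **`IsSimple.hodgeGroupC_prod_ellipticPeriod_prod_ellipticPeriod_eq_blockDiagProd_of_finrank_eq_three_of_forall_apply_ne`**
  (`E_τ` CM, `E_σ ≁ E_τ`, no complex embedding of `F = Z(End⁰ T)` takes the value `τ` ⟹ `Hg((T × E_σ) × E_τ)(ℂ) =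
  Hg(T × E_σ)(ℂ) × Hg(E_τ)(ℂ)`);
  **`IsSimple.forall_divisorClasses_powPeriod_prod_ellipticPeriod_prod_ellipticPeriod_eq_hodgeClasses_of_finrank_eq_three_of_forall_apply_ne`**
  (`(T × E_σ) × E_τ` satisfies (D) outside (e) ∕ (f)).
* §2 every polarised threefold `T`: **`IsRiemannForm.forall_divisorClasses_powPeriod_prod_ellipticPeriod_prod_ellipticPeriod_eq_hodgeClasses_of_finrank_eq_three_of_forall_apply_ne`**,
  the «no embedding `ℚ[τ] ↪ End⁰(T)`» reading `…_of_forall_isEmpty_algHom`, the `IsAbelianVariety.` and isogeny forms.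
* §3 `X ∼ Y × E_τ`, `Y` a NON-SIMPLE polarised fourfold, outside (e) ∕ (f):
  **`IsIsogenous.forall_divisorClasses_powPeriod_eq_hodgeClasses_of_prod_ellipticPeriod_of_not_isSimple_of_finrank_eq_four_of_forall_apply_ne`**,
  `…_of_forall_isEmpty_algHom`, `IsRiemannForm.` forms for `Y × E_τ` itself, and «`Hg(X) = Sp_D(V,φ)`»:
  `IsRiemannForm.hodgeGroup_eq_lefschetzGroup_of_isIsogenous_prod_ellipticPeriod_of_not_isSimple_of_finrank_eq_four_of_forall_apply_ne`.
-/

noncomputable section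

open Module Matrix Complex Function

namespace Literature.Geometry.Kaehler

namespace ComplexTorus

/-! ### §0 Plumbing -/

section Plumbing

variable {ι₁ ι₂ ι₃ : Type*} [Fintype ι₁] [Fintype ι₂] [Fintype ι₃] [DecidableEq ι₁] [DecidableEq ι₂] [DecidableEq ι₃]
  {F₁ F₂ F₃ : Type*} [NormedAddCommGroup F₁] [NormedSpace ℂ F₁] [NormedAddCommGroup F₂] [NormedSpace ℂ F₂]
  [NormedAddCommGroup F₃] [NormedSpace ℂ F₃]

/-- **`(A × B) × C ≅ (A × C) × B`.** [cite: Lange2023AbelianVarietiesComplex, §1.1.2 (products, p. 21)] -/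
private theorem isIsomorphic_prod_prod_swap₅₆ (A : (ι₁ → ℝ) ≃L[ℝ] F₁) (B : (ι₂ → ℝ) ≃L[ℝ] F₂) (C : (ι₃ → ℝ) ≃L[ℝ] F₃) :
    IsIsomorphic (prodPeriod (prodPeriod A B) C) (prodPeriod (prodPeriod A C) B) :=
  ((isIsomorphic_prodPeriod_assoc A B C).trans ((IsIsomorphic.refl A).prod (isIsomorphic_prodPeriod_comm B C))).trans
    (isIsomorphic_prodPeriod_assoc A C B).symm

omit [Fintype ι₂] [Fintype ι₃] [DecidableEq ι₂] [DecidableEq ι₃] [NormedAddCommGroup F₂] [NormedSpace ℂ F₂]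
  [NormedAddCommGroup F₃] [NormedSpace ℂ F₃] in
/-- **Hazama's power remark for two isogenous elliptic factors: `Z × E_ρ` stably nondegenerate and `E_σ ∼ E_ρ` ⟹
`(Z × E_σ) × E_ρ` stably nondegenerate** (`(Z × E_σ) × E_ρ ∼ Z × E_ρ²`, «If not then we are reduced to the case `dim(X) ≤ 4`»).
[cite: MoonenZarhin1999LowDim, §5 (5.11) (p0010 L49–L50), (5.6) (p0009 L113–L114) and §3 (3.1) (p0006 L53–L65)] [cite: Gordon1999HodgeAVSurvey, 7.6.1–7.6.2] -/
private theorem forall_divisorClasses_powPeriod_prod_prod_eq_hodgeClasses_of_isIsogenous₅₆ {Θ : (ι₁ → ℝ) ≃L[ℝ] F₁}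
    (hA : IsAbelianVariety Θ) {σ ρ : ℂ} (hσ : σ.im ≠ 0) (hρ : ρ.im ≠ 0)
    (h : IsIsogenous (ellipticPeriod hσ) (ellipticPeriod hρ))
    (hSN : ∀ k p, divisorClasses (powPeriod (prodPeriod Θ (ellipticPeriod hρ)) k) p =
      hodgeClasses (powPeriod (prodPeriod Θ (ellipticPeriod hρ)) k) p) :
    ∀ k p, divisorClasses (powPeriod (prodPeriod (prodPeriod Θ (ellipticPeriod hσ)) (ellipticPeriod hρ)) k) p =
      hodgeClasses (powPeriod (prodPeriod (prodPeriod Θ (ellipticPeriod hσ)) (ellipticPeriod hρ)) k) p :=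
  (IsIsogenous.trans _ _ _ (isIsomorphic_prodPeriod_assoc Θ (ellipticPeriod hσ) (ellipticPeriod hρ)).isIsogenous
      ((IsIsogenous.refl Θ).prod (h.prod_powPeriod_two (IsIsogenous.refl (ellipticPeriod hρ)))))
    |>.forall_powPeriod_divisorClasses_eq_hodgeClasses_iff.2
      (hA.forall_divisorClasses_powPeriod_prod_powPeriod_eq_hodgeClasses_of_prod (isAbelianVariety_ellipticPeriod hρ) hSN 2)

end Plumbing

/-! ## §1 `(T × E_σ) × E_τ` for a SIMPLE polarised abelian threefold `T`, outside the cases (e) ∕ (f) -/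

section SimpleThreefold

variable {κ : Type} [Fintype κ] [DecidableEq κ] [Nonempty κ] {E : Type} [NormedAddCommGroup E] [NormedSpace ℂ E]
  [FiniteDimensional ℂ E] {Ψ : (κ → ℝ) ≃L[ℝ] E} {η : E [⋀^Fin 2]→L[ℝ] ℝ} {σ τ : ℂ} (hσ : σ.im ≠ 0) (hτ : τ.im ≠ 0)

/-- **MOONEN–ZARHIN (5.11), `d_max = 3`, THE HODGE GROUP: `T` a SIMPLE threefold, `E_τ` WITH complex multiplication by
`k = ℚ(τ)`, `E_σ ≁ E_τ`, and NO embedding `k ↪ F = End⁰(T)` (no complex embedding `φ` of the centre `F` takes the value `τ`)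
⟹ `Hg((T × E_σ) × E_τ)(ℂ) = Hg(T × E_σ)(ℂ) × Hg(E_τ)(ℂ)`** — `Hom(E_τ, T × E_σ) = 0` and the centre of `End⁰(T × E_σ) =
End⁰(T) × End⁰(E_σ)` does not receive `k` («Note that `End⁰(E) = End⁰(Y₁)` implies that `E ∼ Y₁`, which we excluded. Again
by Proposition (3.8) we then find `Hg(X) = Hg(E) × Hg(Y)`»).
[cite: MoonenZarhin1999LowDim, §5 (5.11) (p0010 L57–L63) and §3 Prop. (3.8) (p0007 L55–L74)] [cite: Lange2023AbelianVarietiesComplex, §2.4.4 Cor. 2.4.26 and §5.1.5 Exercise (1)] -/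
theorem IsSimple.hodgeGroupC_prod_ellipticPeriod_prod_ellipticPeriod_eq_blockDiagProd_of_finrank_eq_three_of_forall_apply_ne
    (hT : IsSimple Ψ) (hη : IsRiemannForm Ψ η) (h3 : finrank ℂ E = 3) (hCM : ellipticEnd hτ ≠ ⊥)
    (hni : ¬ IsIsogenous (ellipticPeriod hσ) (ellipticPeriod hτ)) (hne : ∀ φ : centerField Ψ hT →+* ℂ, ∀ c, φ c ≠ τ) :
    hodgeGroupC (prodPeriod (prodPeriod Ψ (ellipticPeriod hσ)) (ellipticPeriod hτ)) =
      blockDiagProd (hodgeGroupC (prodPeriod Ψ (ellipticPeriod hσ))) (hodgeGroupC (ellipticPeriod hτ)) := by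
  have hcard : Fintype.card κ ≠ Fintype.card (Fin 2) := by
    rw [card_eq_two_mul_finrank Ψ, h3, Fintype.card_fin]; norm_num
  by_contra h
  rcases IsAbelianVariety.exists_algHom_center_endAlgRat_or_isIsogenous_of_hodgeGroupC_prod_ellipticPeriod_prod_ellipticPeriod_ne
      hτ hσ ⟨η, hη⟩ (hT.homRat_eq_bot_of_card_ne (isSimple_ellipticPeriod hσ) hcard)
      ((isSimple_ellipticPeriod hσ).homRat_eq_bot_of_card_ne hT fun h' ↦ hcard h'.symm) hCM h with ⟨χ, hτχ⟩ | h'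
  · -- a character of `Z(End⁰ T) = F` with the value `τ`: an embedding `k ↪ F`
    obtain ⟨c, hc⟩ := (AlgHom.mem_range χ).1 hτχ
    obtain ⟨φ, hφ⟩ : ∃ φ : centerField Ψ hT →+* ℂ, ∀ x, φ x = χ x := ⟨χ.toRingHom, fun _ ↦ rfl⟩
    exact hne φ c ((hφ c).trans hc)
  · exact hni h'

/-- **MOONEN–ZARHIN THM. (0.2) (4) FOR `X = (T × E_σ) × E_τ`, `T` A SIMPLE THREEFOLD, OUTSIDE (e) ∕ (f): `ℬ•(Xⁿ) = 𝒟•(Xⁿ)`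
for all `n`** — hypotheses: when `E_σ` (resp. `E_τ`) has complex multiplication by `k`, no embedding `k ↪ F = End⁰(T)` (no
complex embedding of the centre `F` takes the value `σ`, resp. `τ`).  `E_τ` non-CM: the non-CM factor theorem on
`T × E_σ` (Thm. (0.1) (4) outside (a)); `E_σ` non-CM: the same after swapping the curves; both CM and `E_σ ∼ E_τ`: `X ∼ T ×
E_τ²`; both CM, `E_σ ≁ E_τ`: the Hodge group splits (previous theorem) and (D) transfers from `T × E_σ` and `E_τ`.
[cite: MoonenZarhin1999LowDim, Thm. (0.2) (4) (p0002 L1–L8), cases (e), (f) (p0001 L127–L135), §5 (5.11) (p0010 L47–L63), (5.6) (p0009 L122–L126), §3 (3.1), Prop. (3.8)]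
[cite: Gordon1999HodgeAVSurvey, Thm. 7.5 and 7.6.1–7.6.2] -/
theorem IsSimple.forall_divisorClasses_powPeriod_prod_ellipticPeriod_prod_ellipticPeriod_eq_hodgeClasses_of_finrank_eq_three_of_forall_apply_ne
    (hT : IsSimple Ψ) (hη : IsRiemannForm Ψ η) (h3 : finrank ℂ E = 3)
    (hσa : ellipticEnd hσ ≠ ⊥ → ∀ φ : centerField Ψ hT →+* ℂ, ∀ c, φ c ≠ σ)
    (hτa : ellipticEnd hτ ≠ ⊥ → ∀ φ : centerField Ψ hT →+* ℂ, ∀ c, φ c ≠ τ) :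
    ∀ k p, divisorClasses (powPeriod (prodPeriod (prodPeriod Ψ (ellipticPeriod hσ)) (ellipticPeriod hτ)) k) p =
      hodgeClasses (powPeriod (prodPeriod (prodPeriod Ψ (ellipticPeriod hσ)) (ellipticPeriod hτ)) k) p := by
  have hAT : IsAbelianVariety Ψ := ⟨η, hη⟩
  -- `T × E_ρ` is stably nondegenerate for `ρ ∈ {σ, τ}` (Thm. (0.1) (4) outside case (a))
  have hSNσ := hη.forall_divisorClasses_powPeriod_prod_ellipticPeriod_eq_hodgeClasses_of_finrank_eq_three_of_forall_apply_ne
    hσ h3 fun _ ↦ hσa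
  have hSNτ := hη.forall_divisorClasses_powPeriod_prod_ellipticPeriod_eq_hodgeClasses_of_finrank_eq_three_of_forall_apply_ne
    hτ h3 fun _ ↦ hτa
  by_cases hEτ : ellipticEnd hτ = ⊥
  · exact (hAT.prod (isAbelianVariety_ellipticPeriod hσ))
      |>.forall_divisorClasses_powPeriod_prod_ellipticPeriod_eq_hodgeClasses_of_ellipticEnd_eq_bot hτ hEτ hSNσ
  by_cases hEσ : ellipticEnd hσ = ⊥
  · -- `(T × E_σ) × E_τ ≅ (T × E_τ) × E_σ`
    exact (isIsomorphic_prod_prod_swap₅₆ Ψ (ellipticPeriod hσ) (ellipticPeriod hτ)).isIsogenous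
      |>.forall_powPeriod_divisorClasses_eq_hodgeClasses_iff.2
        ((hAT.prod (isAbelianVariety_ellipticPeriod hτ))
          |>.forall_divisorClasses_powPeriod_prod_ellipticPeriod_eq_hodgeClasses_of_ellipticEnd_eq_bot hσ hEσ hSNτ)
  by_cases hi : IsIsogenous (ellipticPeriod hσ) (ellipticPeriod hτ)
  · exact forall_divisorClasses_powPeriod_prod_prod_eq_hodgeClasses_of_isIsogenous₅₆ hAT hσ hτ hi hSNτ
  · exact forall_divisorClasses_powPeriod_prod_eq_hodgeClasses_of_hodgeGroupC_prod_eq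
      (hT.hodgeGroupC_prod_ellipticPeriod_prod_ellipticPeriod_eq_blockDiagProd_of_finrank_eq_three_of_forall_apply_ne hσ hτ hη
        h3 hEτ hi (hτa hEτ))
      hSNσ (fun k p ↦ divisorClasses_eq_hodgeClasses_ellipticPow hτ k p)

/-- **The same with «no embedding `ℚ[σ] ↪ End⁰(T)`, `ℚ[τ] ↪ End⁰(T)`» read literally** (`End⁰(T) = F` is its own centre for
a simple threefold, ✔ g54-#1 §1). [cite: MoonenZarhin1999LowDim, Thm. (0.2) (4) (p0002 L1–L8), cases (a), (e), (f) (p0001 L77–L80, L127–L135)] -/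
theorem IsSimple.forall_divisorClasses_powPeriod_prod_ellipticPeriod_prod_ellipticPeriod_eq_hodgeClasses_of_finrank_eq_three_of_isEmpty_algHom
    (hT : IsSimple Ψ) (hη : IsRiemannForm Ψ η) (h3 : finrank ℂ E = 3)
    (hσa : ellipticEnd hσ ≠ ⊥ → IsEmpty (Algebra.adjoin ℚ {σ} →ₐ[ℚ] endAlgRat Ψ))
    (hτa : ellipticEnd hτ ≠ ⊥ → IsEmpty (Algebra.adjoin ℚ {τ} →ₐ[ℚ] endAlgRat Ψ)) :
    ∀ k p, divisorClasses (powPeriod (prodPeriod (prodPeriod Ψ (ellipticPeriod hσ)) (ellipticPeriod hτ)) k) p =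
      hodgeClasses (powPeriod (prodPeriod (prodPeriod Ψ (ellipticPeriod hσ)) (ellipticPeriod hτ)) k) p :=
  hT.forall_divisorClasses_powPeriod_prod_ellipticPeriod_prod_ellipticPeriod_eq_hodgeClasses_of_finrank_eq_three_of_forall_apply_ne
    hσ hτ hη h3
    (fun hE ↦ hT.forall_ringHom_centerField_apply_ne_of_isEmpty_algHom_endAlgRat_of_finrank_eq_three h3 hσ hE (hσa hE))
    (fun hE ↦ hT.forall_ringHom_centerField_apply_ne_of_isEmpty_algHom_endAlgRat_of_finrank_eq_three h3 hτ hE (hτa hE))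

end SimpleThreefold

/-! ## §2 `(T × E_σ) × E_τ` for EVERY polarised abelian threefold `T` -/

section Threefold

variable {κ : Type} [Fintype κ] [DecidableEq κ] [Nonempty κ] {E : Type} [NormedAddCommGroup E] [NormedSpace ℂ E]
  [FiniteDimensional ℂ E] {Ψ : (κ → ℝ) ≃L[ℝ] E} {η : E [⋀^Fin 2]→L[ℝ] ℝ} {σ τ : ℂ} (hσ : σ.im ≠ 0) (hτ : τ.im ≠ 0)

/-- **MOONEN–ZARHIN THM. (0.2) (4) FOR `X = (T × E_σ) × E_τ`, EVERY POLARISED COMPLEX ABELIAN THREEFOLD `T`, OUTSIDE (e) ∕ (f):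
`ℬ•(Xⁿ) = 𝒟•(Xⁿ)` for all `n`** — hypothesis: when `T` is simple and `E_σ` (resp. `E_τ`) has complex multiplication by
`k`, no complex embedding of the centre `F` of `End⁰(T)` takes the value `σ` (resp. `τ`) («no embedding `k ↪ End⁰(X₂)`»);
a non-simple `T ∼ S × E_ρ` gives `X ∼ ((S × E_ρ) × E_σ) × E_τ`, all simple factors of dimension `≤ 2` (✔ g55-#1).
[cite: MoonenZarhin1999LowDim, Thm. (0.2) (4) (p0002 L1–L8), cases (a), (e), (f) (p0001 L77–L80, L127–L135) and §5 (5.11) (p0010 L47–L63)]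
[cite: Gordon1999HodgeAVSurvey, Thm. 7.5 and 7.6.1–7.6.2] [cite: Lange2023AbelianVarietiesComplex, §2.4.4 Thm. 2.4.25] -/
theorem IsRiemannForm.forall_divisorClasses_powPeriod_prod_ellipticPeriod_prod_ellipticPeriod_eq_hodgeClasses_of_finrank_eq_three_of_forall_apply_ne
    (hη : IsRiemannForm Ψ η) (h3 : finrank ℂ E = 3)
    (ha : ∀ hT : IsSimple Ψ, (ellipticEnd hσ ≠ ⊥ → ∀ φ : centerField Ψ hT →+* ℂ, ∀ c, φ c ≠ σ) ∧
      (ellipticEnd hτ ≠ ⊥ → ∀ φ : centerField Ψ hT →+* ℂ, ∀ c, φ c ≠ τ)) :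
    ∀ k p, divisorClasses (powPeriod (prodPeriod (prodPeriod Ψ (ellipticPeriod hσ)) (ellipticPeriod hτ)) k) p =
      hodgeClasses (powPeriod (prodPeriod (prodPeriod Ψ (ellipticPeriod hσ)) (ellipticPeriod hτ)) k) p := by
  by_cases hT : IsSimple Ψ
  · exact hT.forall_divisorClasses_powPeriod_prod_ellipticPeriod_prod_ellipticPeriod_eq_hodgeClasses_of_finrank_eq_three_of_forall_apply_ne
      hσ hτ hη h3 (ha hT).1 (ha hT).2
  · -- `T ∼ S × E_ρ` with `S = π(V)` a polarised abelian surface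
    obtain ⟨V, hV, hVc, ρ, hρ, h2, hiso⟩ :=
      hη.exists_isIsogenous_subtorusPeriod_prod_ellipticPeriod_of_not_isSimple_of_finrank_eq_three h3 hT
    exact ((hiso.prod (IsIsogenous.refl (ellipticPeriod hσ))).prod (IsIsogenous.refl (ellipticPeriod hτ)))
      |>.forall_powPeriod_divisorClasses_eq_hodgeClasses_iff.2
        ((isRiemannForm_restrict Ψ hη hV hVc).forall_divisorClasses_powPeriod_prod_ellipticPeriod_prod_ellipticPeriod_prod_ellipticPeriod_eq_hodgeClasses_of_finrank_eq_two
          hρ hσ hτ h2)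

/-- **The same with the hypothesis read literally as «no embedding `ℚ[σ] ↪ End⁰(T)`, `ℚ[τ] ↪ End⁰(T)` when `T` is simple».**
[cite: MoonenZarhin1999LowDim, Thm. (0.2) (4) (p0002 L1–L8), cases (a), (e), (f) (p0001 L77–L80, L127–L135)] -/
theorem IsRiemannForm.forall_divisorClasses_powPeriod_prod_ellipticPeriod_prod_ellipticPeriod_eq_hodgeClasses_of_finrank_eq_three_of_forall_isEmpty_algHom
    (hη : IsRiemannForm Ψ η) (h3 : finrank ℂ E = 3)
    (ha : IsSimple Ψ → (ellipticEnd hσ ≠ ⊥ → IsEmpty (Algebra.adjoin ℚ {σ} →ₐ[ℚ] endAlgRat Ψ)) ∧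
      (ellipticEnd hτ ≠ ⊥ → IsEmpty (Algebra.adjoin ℚ {τ} →ₐ[ℚ] endAlgRat Ψ))) :
    ∀ k p, divisorClasses (powPeriod (prodPeriod (prodPeriod Ψ (ellipticPeriod hσ)) (ellipticPeriod hτ)) k) p =
      hodgeClasses (powPeriod (prodPeriod (prodPeriod Ψ (ellipticPeriod hσ)) (ellipticPeriod hτ)) k) p := by
  refine hη.forall_divisorClasses_powPeriod_prod_ellipticPeriod_prod_ellipticPeriod_eq_hodgeClasses_of_finrank_eq_three_of_forall_apply_ne
    hσ hτ h3 fun hT ↦ ⟨fun hE ↦ ?_, fun hE ↦ ?_⟩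
  · exact hT.forall_ringHom_centerField_apply_ne_of_isEmpty_algHom_endAlgRat_of_finrank_eq_three h3 hσ hE ((ha hT).1 hE)
  · exact hT.forall_ringHom_centerField_apply_ne_of_isEmpty_algHom_endAlgRat_of_finrank_eq_three h3 hτ hE ((ha hT).2 hE)

/-- The `IsAbelianVariety` form (the hypothesis quantified over the polarisation-free `IsSimple`): `(T × E_σ) × E_τ` satisfies
(D) for every complex abelian threefold `T` outside (e) ∕ (f). [cite: MoonenZarhin1999LowDim, Thm. (0.2) (4) (p0002 L1–L8) and §5 (5.11) (p0010 L47–L63)] -/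
theorem IsAbelianVariety.forall_divisorClasses_powPeriod_prod_ellipticPeriod_prod_ellipticPeriod_eq_hodgeClasses_of_finrank_eq_three_of_forall_isEmpty_algHom
    (hA : IsAbelianVariety Ψ) (h3 : finrank ℂ E = 3)
    (ha : IsSimple Ψ → (ellipticEnd hσ ≠ ⊥ → IsEmpty (Algebra.adjoin ℚ {σ} →ₐ[ℚ] endAlgRat Ψ)) ∧
      (ellipticEnd hτ ≠ ⊥ → IsEmpty (Algebra.adjoin ℚ {τ} →ₐ[ℚ] endAlgRat Ψ))) :
    ∀ k p, divisorClasses (powPeriod (prodPeriod (prodPeriod Ψ (ellipticPeriod hσ)) (ellipticPeriod hτ)) k) p =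
      hodgeClasses (powPeriod (prodPeriod (prodPeriod Ψ (ellipticPeriod hσ)) (ellipticPeriod hτ)) k) p := by
  obtain ⟨η, hη⟩ := hA
  exact hη.forall_divisorClasses_powPeriod_prod_ellipticPeriod_prod_ellipticPeriod_eq_hodgeClasses_of_finrank_eq_three_of_forall_isEmpty_algHom
    hσ hτ h3 ha

end Threefold

section ThreefoldIsogenous

variable {ι : Type*} [Fintype ι] [DecidableEq ι] {F : Type*} [NormedAddCommGroup F] [NormedSpace ℂ F]
  {Φ : (ι → ℝ) ≃L[ℝ] F}
  {κ : Type} [Fintype κ] [DecidableEq κ] {E : Type} [NormedAddCommGroup E] [NormedSpace ℂ E] [FiniteDimensional ℂ E]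
  {Ψ : (κ → ℝ) ≃L[ℝ] E} {η : E [⋀^Fin 2]→L[ℝ] ℝ} {σ τ : ℂ} (hσ : σ.im ≠ 0) (hτ : τ.im ≠ 0)

/-- **Every complex torus ISOGENOUS to `(T × E_σ) × E_τ` (a polarised threefold and two elliptic curves) outside (e) ∕ (f)
satisfies condition (D).** [cite: MoonenZarhin1999LowDim, Thm. (0.2) (4) (p0002 L1–L8), cases (e), (f) (p0001 L127–L135)] [cite: Lange2023AbelianVarietiesComplex, §1.1.2 Cor. 1.1.16] -/
theorem IsIsogenous.forall_divisorClasses_powPeriod_eq_hodgeClasses_of_prod_ellipticPeriod_prod_ellipticPeriod_of_finrank_eq_three_of_forall_isEmpty_algHom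
    (hiso : IsIsogenous Φ (prodPeriod (prodPeriod Ψ (ellipticPeriod hσ)) (ellipticPeriod hτ))) (hη : IsRiemannForm Ψ η)
    (h3 : finrank ℂ E = 3)
    (ha : IsSimple Ψ → (ellipticEnd hσ ≠ ⊥ → IsEmpty (Algebra.adjoin ℚ {σ} →ₐ[ℚ] endAlgRat Ψ)) ∧
      (ellipticEnd hτ ≠ ⊥ → IsEmpty (Algebra.adjoin ℚ {τ} →ₐ[ℚ] endAlgRat Ψ))) :
    ∀ k p, divisorClasses (powPeriod Φ k) p = hodgeClasses (powPeriod Φ k) p := by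
  haveI : Nonempty κ := Fintype.card_pos_iff.1 (by rw [card_eq_two_mul_finrank Ψ, h3]; norm_num)
  exact hiso.forall_powPeriod_divisorClasses_eq_hodgeClasses_iff.2
    (hη.forall_divisorClasses_powPeriod_prod_ellipticPeriod_prod_ellipticPeriod_eq_hodgeClasses_of_finrank_eq_three_of_forall_isEmpty_algHom
      hσ hτ h3 ha)

end ThreefoldIsogenous

/-! ## §3 `X ∼ Y × E_τ` with `Y` a NON-SIMPLE polarised abelian fourfold, outside the cases (e) ∕ (f) -/

section NonSimpleFourfold

variable {ι : Type*} [Fintype ι] [DecidableEq ι] {F : Type*} [NormedAddCommGroup F] [NormedSpace ℂ F]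
  {Φ : (ι → ℝ) ≃L[ℝ] F}
  {κ : Type} [Fintype κ] [DecidableEq κ] {E : Type} [NormedAddCommGroup E] [NormedSpace ℂ E] [FiniteDimensional ℂ E]
  {Ψ : (κ → ℝ) ≃L[ℝ] E} {η : E [⋀^Fin 2]→L[ℝ] ℝ} {τ : ℂ} (hτ : τ.im ≠ 0)

/-- **MOONEN–ZARHIN THM. (0.2) (4) FOR `X ∼ Y × E`, `Y` A NON-SIMPLE POLARISED COMPLEX ABELIAN FOURFOLD, OUTSIDE (e) ∕ (f):
`X` SATISFIES CONDITION (D)** — `ℬ•(Xⁿ) = 𝒟•(Xⁿ)` for all `n`.  «Not (e), not (f)» (hypothesis `hef`, the tree's working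
form): for every SIMPLE polarised threefold `T` and elliptic curves `E_σ`, `E_ρ` with `X ∼ (T × E_σ) × E_ρ` and `E_ρ` with
complex multiplication by `k = ℚ(ρ)`, no complex embedding of `F = End⁰(T)` takes the value `ρ` (no embedding `k ↪ End⁰(T)`).
PROOF: `Y ∼ T × E_σ` or `Y ∼ S₁ × S₂` (Poincaré); then `X ∼ (T × E_σ) × E_τ` (§2, the hypothesis for `σ` from `X ∼ (T × E_τ) ×
E_σ`) or `X ∼ (S₁ × S₂) × E_τ` (✔ g55-#1).  A SIMPLE `Y` is the excluded «simple factor of dimension 4».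
[cite: MoonenZarhin1999LowDim, Thm. (0.2) (4) (p0002 L1–L8), cases (a), (e), (f) (p0001 L77–L80, L127–L135), §5 (5.11) (p0010 L47–L63) and (5.4)–(5.5) (p0009 L82–L100)]
[cite: Lange2023AbelianVarietiesComplex, §2.4.4 Thm. 2.4.25 and §1.1.2 Cor. 1.1.16] [cite: Gordon1999HodgeAVSurvey, Thm. 7.5 and 7.6.1–7.6.2] -/
theorem IsIsogenous.forall_divisorClasses_powPeriod_eq_hodgeClasses_of_prod_ellipticPeriod_of_not_isSimple_of_finrank_eq_four_of_forall_apply_ne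
    (hiso : IsIsogenous Φ (prodPeriod Ψ (ellipticPeriod hτ))) (hη : IsRiemannForm Ψ η) (h4 : finrank ℂ E = 4)
    (hY : ¬ IsSimple Ψ)
    (hef : ∀ {κ' : Type} [Fintype κ'] [DecidableEq κ'] [Nonempty κ'] {E' : Type} [NormedAddCommGroup E'] [NormedSpace ℂ E']
      [FiniteDimensional ℂ E'] {Ψ' : (κ' → ℝ) ≃L[ℝ] E'} {η' : E' [⋀^Fin 2]→L[ℝ] ℝ}, IsRiemannForm Ψ' η' →
      finrank ℂ E' = 3 → ∀ (hT : IsSimple Ψ') {σ : ℂ} (hσ : σ.im ≠ 0) {ρ : ℂ} (hρ : ρ.im ≠ 0),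
      IsIsogenous Φ (prodPeriod (prodPeriod Ψ' (ellipticPeriod hσ)) (ellipticPeriod hρ)) → ellipticEnd hρ ≠ ⊥ →
      ∀ φ : centerField Ψ' hT →+* ℂ, ∀ c, φ c ≠ ρ) :
    ∀ k p, divisorClasses (powPeriod Φ k) p = hodgeClasses (powPeriod Φ k) p := by
  rcases hη.exists_isIsogenous_prod_of_not_isSimple_of_finrank_eq_four h4 hY with
    ⟨V, hV, hVc, σ, hσ, h3, hYiso⟩ | ⟨V, hV, hVc, hW, hWc, h2, h2', hYiso⟩
  · -- `Y ∼ T × E_σ`, `T = π(V)` a polarised threefold: `X ∼ (T × E_σ) × E_τ ≅ (T × E_τ) × E_σ`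
    haveI : Nonempty (Fin (subRank V)) := ⟨⟨0, by rw [subRank_eq_two_mul_finrank Ψ hV hVc, h3]; norm_num⟩⟩
    have hX : IsIsogenous Φ (prodPeriod (prodPeriod (subtorusPeriod Ψ V hV hVc) (ellipticPeriod hσ)) (ellipticPeriod hτ)) :=
      IsIsogenous.trans _ _ _ hiso (hYiso.prod (IsIsogenous.refl (ellipticPeriod hτ)))
    have hX' : IsIsogenous Φ (prodPeriod (prodPeriod (subtorusPeriod Ψ V hV hVc) (ellipticPeriod hτ)) (ellipticPeriod hσ)) :=
      IsIsogenous.trans _ _ _ hX (isIsomorphic_prod_prod_swap₅₆ (subtorusPeriod Ψ V hV hVc) (ellipticPeriod hσ)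
        (ellipticPeriod hτ)).isIsogenous
    exact hX.forall_powPeriod_divisorClasses_eq_hodgeClasses_iff.2
      ((isRiemannForm_restrict Ψ hη hV hVc).forall_divisorClasses_powPeriod_prod_ellipticPeriod_prod_ellipticPeriod_eq_hodgeClasses_of_finrank_eq_three_of_forall_apply_ne
        hσ hτ h3 fun hT ↦ ⟨fun hE ↦ hef (isRiemannForm_restrict Ψ hη hV hVc) h3 hT hτ hσ hX' hE,
          fun hE ↦ hef (isRiemannForm_restrict Ψ hη hV hVc) h3 hT hσ hτ hX hE⟩)
  · -- `Y ∼ S₁ × S₂`, two polarised abelian surfaces: `X ∼ (S₁ × S₂) × E_τ`, all simple factors of dimension `≤ 2`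
    exact (IsIsogenous.trans _ _ _ hiso (hYiso.prod (IsIsogenous.refl (ellipticPeriod hτ))))
      |>.forall_powPeriod_divisorClasses_eq_hodgeClasses_iff.2
        ((isRiemannForm_restrict Ψ hη hV hVc).forall_divisorClasses_powPeriod_prod_prod_ellipticPeriod_eq_hodgeClasses_of_finrank_eq_two_two
          hτ (isRiemannForm_restrict Ψ hη hW hWc) h2 h2')

/-- **The same with «not (e), not (f)» read literally: for every simple polarised threefold `T` and curves `E_σ`, `E_ρ` with
`X ∼ (T × E_σ) × E_ρ` and `E_ρ` with complex multiplication, NO embedding `ℚ[ρ] = End⁰(E_ρ) ↪ End⁰(T)`.**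
[cite: MoonenZarhin1999LowDim, Thm. (0.2) (4) (p0002 L1–L8), cases (a), (e), (f) (p0001 L77–L80, L127–L135)] -/
theorem IsIsogenous.forall_divisorClasses_powPeriod_eq_hodgeClasses_of_prod_ellipticPeriod_of_not_isSimple_of_finrank_eq_four_of_forall_isEmpty_algHom
    (hiso : IsIsogenous Φ (prodPeriod Ψ (ellipticPeriod hτ))) (hη : IsRiemannForm Ψ η) (h4 : finrank ℂ E = 4)
    (hY : ¬ IsSimple Ψ)
    (hef : ∀ {κ' : Type} [Fintype κ'] [DecidableEq κ'] {E' : Type} [NormedAddCommGroup E'] [NormedSpace ℂ E']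
      [FiniteDimensional ℂ E'] {Ψ' : (κ' → ℝ) ≃L[ℝ] E'} {η' : E' [⋀^Fin 2]→L[ℝ] ℝ}, IsRiemannForm Ψ' η' →
      finrank ℂ E' = 3 → IsSimple Ψ' → ∀ {σ : ℂ} (hσ : σ.im ≠ 0) {ρ : ℂ} (hρ : ρ.im ≠ 0),
      IsIsogenous Φ (prodPeriod (prodPeriod Ψ' (ellipticPeriod hσ)) (ellipticPeriod hρ)) → ellipticEnd hρ ≠ ⊥ →
      IsEmpty (Algebra.adjoin ℚ {ρ} →ₐ[ℚ] endAlgRat Ψ')) :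
    ∀ k p, divisorClasses (powPeriod Φ k) p = hodgeClasses (powPeriod Φ k) p :=
  hiso.forall_divisorClasses_powPeriod_eq_hodgeClasses_of_prod_ellipticPeriod_of_not_isSimple_of_finrank_eq_four_of_forall_apply_ne
    hτ hη h4 hY fun hη' h3 hT _ hσ _ hρ hX hE ↦
      hT.forall_ringHom_centerField_apply_ne_of_isEmpty_algHom_endAlgRat_of_finrank_eq_three h3 hρ hE (hef hη' h3 hT hσ hρ hX hE)

/-- **`Y × E_τ` ITSELF satisfies (D) for every non-simple polarised fourfold `Y` outside (e) ∕ (f).**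
[cite: MoonenZarhin1999LowDim, Thm. (0.2) (4) (p0002 L1–L8) and §5 (5.11) (p0010 L47–L63)] -/
theorem IsRiemannForm.forall_divisorClasses_powPeriod_prod_ellipticPeriod_eq_hodgeClasses_of_not_isSimple_of_finrank_eq_four_of_forall_isEmpty_algHom
    (hη : IsRiemannForm Ψ η) (h4 : finrank ℂ E = 4) (hY : ¬ IsSimple Ψ)
    (hef : ∀ {κ' : Type} [Fintype κ'] [DecidableEq κ'] {E' : Type} [NormedAddCommGroup E'] [NormedSpace ℂ E']
      [FiniteDimensional ℂ E'] {Ψ' : (κ' → ℝ) ≃L[ℝ] E'} {η' : E' [⋀^Fin 2]→L[ℝ] ℝ}, IsRiemannForm Ψ' η' →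
      finrank ℂ E' = 3 → IsSimple Ψ' → ∀ {σ : ℂ} (hσ : σ.im ≠ 0) {ρ : ℂ} (hρ : ρ.im ≠ 0),
      IsIsogenous (prodPeriod Ψ (ellipticPeriod hτ)) (prodPeriod (prodPeriod Ψ' (ellipticPeriod hσ)) (ellipticPeriod hρ)) →
      ellipticEnd hρ ≠ ⊥ → IsEmpty (Algebra.adjoin ℚ {ρ} →ₐ[ℚ] endAlgRat Ψ')) :
    ∀ k p, divisorClasses (powPeriod (prodPeriod Ψ (ellipticPeriod hτ)) k) p =
      hodgeClasses (powPeriod (prodPeriod Ψ (ellipticPeriod hτ)) k) p :=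
  (IsIsogenous.refl _).forall_divisorClasses_powPeriod_eq_hodgeClasses_of_prod_ellipticPeriod_of_not_isSimple_of_finrank_eq_four_of_forall_isEmpty_algHom
    hτ hη h4 hY hef

/-- **A NON-SIMPLE POLARISED FOURFOLD `Y` AND A CURVE `E_τ` SUCH THAT NO CM ELLIPTIC CURVE MAPS NON-TRIVIALLY TO `Y × E_τ`
EXCEPT THROUGH … — simplest sufficient form: if `Hom_ℚ(E_ρ, Y × E_τ) = 0` for every elliptic curve `E_ρ` with complex
multiplication, then `Y × E_τ` satisfies (D)** (an isogeny factor `E_ρ` of `X ∼ (T × E_σ) × E_ρ` has `Hom_ℚ(E_ρ, X) ≠ 0`).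
[cite: MoonenZarhin1999LowDim, Thm. (0.2) (4) (p0002 L1–L8), cases (e), (f) (p0001 L127–L135)] [cite: Lange2023AbelianVarietiesComplex, §2.4.4 Cor. 2.4.26 and §1.1.2 Cor. 1.1.16] -/
theorem IsRiemannForm.forall_divisorClasses_powPeriod_prod_ellipticPeriod_eq_hodgeClasses_of_not_isSimple_of_finrank_eq_four_of_forall_homRat_eq_bot
    (hη : IsRiemannForm Ψ η) (h4 : finrank ℂ E = 4) (hY : ¬ IsSimple Ψ)
    (hCM : ∀ (ρ : ℂ) (hρ : ρ.im ≠ 0), ellipticEnd hρ ≠ ⊥ → homRat (ellipticPeriod hρ) (prodPeriod Ψ (ellipticPeriod hτ)) = ⊥) :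
    ∀ k p, divisorClasses (powPeriod (prodPeriod Ψ (ellipticPeriod hτ)) k) p =
      hodgeClasses (powPeriod (prodPeriod Ψ (ellipticPeriod hτ)) k) p :=
  hη.forall_divisorClasses_powPeriod_prod_ellipticPeriod_eq_hodgeClasses_of_not_isSimple_of_finrank_eq_four_of_forall_isEmpty_algHom
    hτ h4 hY fun _ _ _ _ _ _ hρ hX hE ↦ absurd (hCM _ hρ hE) hX.homRat_ne_bot_of_prod_right

/-- **«`Hg(X) = Sp_D(V,φ)`» FOR `X ∼ Y × E_τ`, `Y` A NON-SIMPLE FOURFOLD, OUTSIDE (e) ∕ (f)** (real points `Hg(X)(ℝ) =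
S(X)(ℝ)`, the full centraliser of `End⁰(X)` in the symplectic group of any polarisation `ω` of `X`) — from (D) by Gordon's
Thm. 7.5 (1) ⟹ (2). [cite: MoonenZarhin1999LowDim, Thm. (0.2) (4) (p0002 L5–L8: «then `Hg(X) = Sp_D(V,φ)`»)]
[cite: Gordon1999HodgeAVSurvey, Thm. 7.5 (1) ⟺ (2)] [cite: Milne1999LefschetzClasses, §4 Prop. 4.8] -/
theorem IsRiemannForm.hodgeGroup_eq_lefschetzGroup_of_isIsogenous_prod_ellipticPeriod_of_not_isSimple_of_finrank_eq_four_of_forall_isEmpty_algHom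
    {ι' : Type} [Fintype ι'] [DecidableEq ι'] {F' : Type} [NormedAddCommGroup F'] [NormedSpace ℂ F'] [FiniteDimensional ℂ F']
    {Φ' : (ι' → ℝ) ≃L[ℝ] F'} {ω : F' [⋀^Fin 2]→L[ℝ] ℝ} (hω : IsRiemannForm Φ' ω)
    (hiso : IsIsogenous Φ' (prodPeriod Ψ (ellipticPeriod hτ))) (hη : IsRiemannForm Ψ η) (h4 : finrank ℂ E = 4)
    (hY : ¬ IsSimple Ψ)
    (hef : ∀ {κ' : Type} [Fintype κ'] [DecidableEq κ'] {E' : Type} [NormedAddCommGroup E'] [NormedSpace ℂ E']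
      [FiniteDimensional ℂ E'] {Ψ' : (κ' → ℝ) ≃L[ℝ] E'} {η' : E' [⋀^Fin 2]→L[ℝ] ℝ}, IsRiemannForm Ψ' η' →
      finrank ℂ E' = 3 → IsSimple Ψ' → ∀ {σ : ℂ} (hσ : σ.im ≠ 0) {ρ : ℂ} (hρ : ρ.im ≠ 0),
      IsIsogenous Φ' (prodPeriod (prodPeriod Ψ' (ellipticPeriod hσ)) (ellipticPeriod hρ)) → ellipticEnd hρ ≠ ⊥ →
      IsEmpty (Algebra.adjoin ℚ {ρ} →ₐ[ℚ] endAlgRat Ψ')) :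
    hodgeGroup Φ' = lefschetzGroup Φ' ω := by
  obtain ⟨G, hG⟩ := hω.exists_ratMatrix_latticeGram
  have h0 : 0 < finrank ℂ F' := by
    have hc := hiso.card_eq
    rw [Fintype.card_sum, card_eq_two_mul_finrank Φ', card_eq_two_mul_finrank Ψ, h4] at hc
    omega
  exact ((hω.forall_divisorClasses_powPeriod_eq_hodgeClasses_iff_eq_and_hodgeGroup_eq_lefschetzGroup hG h0).1
    (hiso.forall_divisorClasses_powPeriod_eq_hodgeClasses_of_prod_ellipticPeriod_of_not_isSimple_of_finrank_eq_four_of_forall_isEmpty_algHom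
      hτ hη h4 hY hef)).2

end NonSimpleFourfold

end ComplexTorus

end Literature.Geometry.Kaehler
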